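import Mathlib.LinearAlgebra.QuadraticForm.IsometryEquiv
import Mathlib.LinearAlgebra.QuadraticForm.Prod
import Mathlib.LinearAlgebra.QuadraticForm.Radical
import Mathlib.LinearAlgebra.QuadraticForm.Signature
import Mathlib.LinearAlgebra.Matrix.BilinearForm
import Mathlib.LinearAlgebra.BilinearForm.Orthogonal
import Mathlib.LinearAlgebra.Determinant
import Mathlib.LinearAlgebra.Basis.Fin
import Mathlib.Tactic.LinearCombination
import Mathlib.Tactic.FieldSimp
import Mathlib.Tactic.FinCases
import HarnessLib

/-!
# Diagonal quadratic forms: regrouping, splitting off a represented value, discriminants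

Topic `Literature/NumberTheory/QuadraticForms`; namespace `Literature.NumberTheory.QuadraticForms`.
Everything here is proved; elementary linear algebra over a field `K` of characteristic `≠ 2`,
written for the weighted sums of squares `⟨w⟩ = ∑ wᵢ xᵢ²` (`QuadraticMap.weightedSumSquares`) of
Mathlib. This is the tool-kit used in `TransferFormProofs.lean` to prove Cor. 11.4 of
Bayer-Fluckiger–van Geemen–Schütt (`BFvGS2025_transfer_realQuadratic_of_det_neg_one`):

* regrouping isometries `⟨w ∘ e⟩ ≅ ⟨w⟩`, `⟨w₁, w₂⟩ ≅ ⟨w₁⟩ ⊥ ⟨w₂⟩`, `⟨a, w⟩ ≅ ⟨a⟩ ⊥ ⟨w⟩`,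
  associativity of `⊥`, `Q₀ ⊥ (⊥ᵢ Qᵢ) ≅ ⊥_{i ≤ k} Qᵢ`;
* `equivalent_weightedSumSquares_cons_of_ne_zero` — **splitting off a represented value**: if a
  quadratic form `Q` on a space of dimension `n + 1` takes the value `a ≠ 0`, then
  `Q ≅ ⟨a, w'⟩` for some `w' : Fin n → K` (extend the vector to an orthogonal basis, Serre,
  *A Course in Arithmetic*, Ch. IV §1.4; Mathlib's `exists_orthogonal_basis` argument);
* `exists_prod_eq_sq_mul_prod` — equivalent diagonal forms have the same discriminant modulo
  squares: `∏ wᵢ = r² ∏ wᵢ'`;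
* `equivalent_weightedSumSquares_pair` — a binary form `⟨a, b⟩` representing `g ≠ 0` is
  `≅ ⟨g, ab/g⟩`;
* sign bookkeeping: negative weights stay negative under equivalence, non-zero weights stay
  non-zero (`Mathlib`'s radical), and Sylvester's law of inertia (Mathlib
  `QuadraticForm.sigPos_of_equiv_weightedSumSquares`) in the form "equivalent diagonal forms have
  the same number of positive weights".

## References

* J.-P. Serre, *A Course in Arithmetic*, GTM 7, Springer 1973, Ch. IV §1 (PDF pp. 27–31).
  [Serre1973]
-/

namespace Literature.NumberTheory.QuadraticForms

open QuadraticMap Module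

/-! ### Regrouping isometries -/

section Regroup

variable {R : Type*} [CommSemiring R]

/-- A quadratic map composed with a linear equivalence is equivalent to itself. [folklore] -/
theorem equivalent_comp_linearEquiv {M M₁ N : Type*} [AddCommMonoid M] [AddCommMonoid M₁]
    [AddCommMonoid N] [Module R M] [Module R M₁] [Module R N] (Q : QuadraticMap R M N)
    (f : M₁ ≃ₗ[R] M) : Equivalent (Q.comp (f : M₁ →ₗ[R] M)) Q :=
  ⟨(isometryEquivOfCompLinearEquiv Q f).symm⟩

variable {K : Type*} [CommRing K]

/-- Reindexing the weights along an equivalence of index types: `⟨w ∘ e⟩ ≅ ⟨w⟩`. [folklore] -/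
theorem equivalent_weightedSumSquares_comp_equiv {ι κ : Type*} [Fintype ι] [Fintype κ]
    (w : κ → K) (e : ι ≃ κ) :
    Equivalent (weightedSumSquares K (w ∘ e)) (weightedSumSquares K w) := by
  have h : weightedSumSquares K (w ∘ e) =
      (weightedSumSquares K w).comp
        ((LinearEquiv.funCongrLeft K K e.symm : (ι → K) ≃ₗ[K] (κ → K)) : (ι → K) →ₗ[K] (κ → K)) := by
    ext v
    simp only [weightedSumSquares_apply, Function.comp_apply, smul_eq_mul, comp_apply,
      LinearEquiv.coe_coe, LinearEquiv.funCongrLeft_apply, LinearMap.funLeft_apply]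
    exact Fintype.sum_equiv e _ _ fun i => by simp
  rw [h]
  exact equivalent_comp_linearEquiv _ _

/-- `⟨w₁, w₂⟩ ≅ ⟨w₁⟩ ⊥ ⟨w₂⟩` for weights indexed by a sum type. [folklore] -/
theorem equivalent_weightedSumSquares_sum_elim {ι κ : Type*} [Fintype ι] [Fintype κ]
    (w₁ : ι → K) (w₂ : κ → K) :
    Equivalent (weightedSumSquares K (Sum.elim w₁ w₂))
      ((weightedSumSquares K w₁).prod (weightedSumSquares K w₂)) := by
  have h : weightedSumSquares K (Sum.elim w₁ w₂) =
      ((weightedSumSquares K w₁).prod (weightedSumSquares K w₂)).comp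
        ((LinearEquiv.sumArrowLequivProdArrow ι κ K K : (ι ⊕ κ → K) ≃ₗ[K] (ι → K) × (κ → K)) :
          (ι ⊕ κ → K) →ₗ[K] (ι → K) × (κ → K)) := by
    ext v
    simp only [weightedSumSquares_apply, smul_eq_mul, comp_apply, LinearEquiv.coe_coe,
      prod_apply, Fintype.sum_sum_type, Sum.elim_inl, Sum.elim_inr,
      LinearEquiv.sumArrowLequivProdArrow_apply_fst, LinearEquiv.sumArrowLequivProdArrow_apply_snd]
  rw [h]
  exact equivalent_comp_linearEquiv _ _

/-- `⟨a, w⟩ ≅ ⟨a⟩ ⊥ ⟨w⟩` (weights `Fin.cons a w`). [folklore] -/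
theorem equivalent_weightedSumSquares_cons {k : ℕ} (a : K) (w : Fin k → K) :
    Equivalent (weightedSumSquares K (Fin.cons a w : Fin (k + 1) → K))
      ((weightedSumSquares K ![a]).prod (weightedSumSquares K w)) := by
  let f : (Fin (k + 1) → K) ≃ₗ[K] (Fin 1 → K) × (Fin k → K) :=
    { toFun := fun v => (fun _ => v 0, Fin.tail v)
      invFun := fun p => Fin.cons (p.1 0) p.2
      map_add' := fun _ _ => rfl
      map_smul' := fun _ _ => rfl
      left_inv := fun v => by simp [Fin.cons_self_tail]
      right_inv := fun p => by
        ext i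
        · simp [Fin.eq_zero i]
        · simp }
  have h : weightedSumSquares K (Fin.cons a w : Fin (k + 1) → K) =
      ((weightedSumSquares K ![a]).prod (weightedSumSquares K w)).comp
        (f : (Fin (k + 1) → K) →ₗ[K] (Fin 1 → K) × (Fin k → K)) := by
    ext v
    simp [f, Fin.sum_univ_succ, Fin.tail]
  rw [h]
  exact equivalent_comp_linearEquiv _ _

/-- Associativity of orthogonal sums. [folklore] -/
theorem equivalent_prod_assoc {M₁ M₂ M₃ N : Type*} [AddCommMonoid M₁] [AddCommMonoid M₂]
    [AddCommMonoid M₃] [AddCommMonoid N] [Module R M₁] [Module R M₂] [Module R M₃] [Module R N]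
    (Q₁ : QuadraticMap R M₁ N) (Q₂ : QuadraticMap R M₂ N) (Q₃ : QuadraticMap R M₃ N) :
    Equivalent ((Q₁.prod Q₂).prod Q₃) (Q₁.prod (Q₂.prod Q₃)) :=
  ⟨{ LinearEquiv.prodAssoc R M₁ M₂ M₃ with
      map_app' := fun x => by simp [add_assoc] }⟩

/-- `Q₀ ⊥ (⊥_{i < k} Qᵢ₊₁) ≅ ⊥_{i ≤ k} Qᵢ` for a family of quadratic maps on one module indexed by
`Fin (k + 1)`. [folklore] -/
theorem equivalent_prod_pi_cons {M N : Type*} [AddCommMonoid M] [AddCommMonoid N] [Module R M]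
    [Module R N] {k : ℕ} (Q : Fin (k + 1) → QuadraticMap R M N) :
    Equivalent ((Q 0).prod (QuadraticMap.pi fun i : Fin k => Q i.succ)) (QuadraticMap.pi Q) := by
  let f : (Fin (k + 1) → M) ≃ₗ[R] M × (Fin k → M) :=
    { toFun := fun v => (v 0, Fin.tail v)
      invFun := fun p => Fin.cons p.1 p.2
      map_add' := fun _ _ => rfl
      map_smul' := fun _ _ => rfl
      left_inv := fun v => by simp [Fin.cons_self_tail]
      right_inv := fun p => by simp }
  have h : QuadraticMap.pi Q =
      ((Q 0).prod (QuadraticMap.pi fun i : Fin k => Q i.succ)).comp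
        (f : (Fin (k + 1) → M) →ₗ[R] M × (Fin k → M)) := by
    ext v
    simp [f, Fin.sum_univ_succ, Fin.tail]
  rw [h]
  exact (equivalent_comp_linearEquiv _ _).symm

/-- `(⊥ᵢ Qᵢ) ⊥ (⊥ⱼ Q'ⱼ) ≅ ⊥_{ι ⊕ κ} (Q, Q')` for families of quadratic maps on one module.
[folklore] -/
theorem equivalent_pi_sum_elim {M N : Type*} [AddCommMonoid M] [AddCommMonoid N] [Module R M]
    [Module R N] {ι κ : Type*} [Fintype ι] [Fintype κ] (Q : ι → QuadraticMap R M N)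
    (Q' : κ → QuadraticMap R M N) :
    Equivalent (QuadraticMap.pi (Sum.elim Q Q')) ((QuadraticMap.pi Q).prod (QuadraticMap.pi Q')) := by
  have h : QuadraticMap.pi (Sum.elim Q Q') =
      ((QuadraticMap.pi Q).prod (QuadraticMap.pi Q')).comp
        ((LinearEquiv.sumArrowLequivProdArrow ι κ R M : (ι ⊕ κ → M) ≃ₗ[R] (ι → M) × (κ → M)) :
          (ι ⊕ κ → M) →ₗ[R] (ι → M) × (κ → M)) := by
    ext v
    simp only [pi_apply, comp_apply, LinearEquiv.coe_coe, prod_apply, Fintype.sum_sum_type,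
      Sum.elim_inl, Sum.elim_inr, LinearEquiv.sumArrowLequivProdArrow_apply_fst,
      LinearEquiv.sumArrowLequivProdArrow_apply_snd]
  rw [h]
  exact equivalent_comp_linearEquiv _ _

/-- Reindexing a family of quadratic maps on one module along an equivalence of index types.
[folklore] -/
theorem equivalent_pi_comp_equiv {M N : Type*} [AddCommMonoid M] [AddCommMonoid N] [Module R M]
    [Module R N] {ι κ : Type*} [Fintype ι] [Fintype κ] (Q : κ → QuadraticMap R M N) (e : ι ≃ κ) :
    Equivalent (QuadraticMap.pi (Q ∘ e)) (QuadraticMap.pi Q) := by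
  have h : QuadraticMap.pi (Q ∘ e) =
      (QuadraticMap.pi Q).comp
        ((LinearEquiv.funCongrLeft R M e.symm : (ι → M) ≃ₗ[R] (κ → M)) : (ι → M) →ₗ[R] (κ → M)) := by
    ext v
    simp only [pi_apply, Function.comp_apply, comp_apply, LinearEquiv.coe_coe,
      LinearEquiv.funCongrLeft_apply, LinearMap.funLeft_apply]
    exact Fintype.sum_equiv e _ _ fun i => by simp
  rw [h]
  exact equivalent_comp_linearEquiv _ _

end Regroup

/-! ### Signs and non-vanishing of the weights under equivalence -/

section Signs

variable {K : Type*} [Field K] [LinearOrder K] [IsStrictOrderedRing K]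

/-- A diagonal form with negative weights takes negative values at non-zero vectors. [folklore] -/
theorem weightedSumSquares_neg_of_ne_zero {ι : Type*} [Fintype ι] {w : ι → K} (hw : ∀ i, w i < 0)
    {v : ι → K} (hv : v ≠ 0) : weightedSumSquares K w v < 0 := by
  obtain ⟨i, hi⟩ : ∃ i, v i ≠ 0 := by
    by_contra h
    push Not at h
    exact hv (funext h)
  rw [weightedSumSquares_apply, ← neg_pos, ← Finset.sum_neg_distrib]
  refine Finset.sum_pos' (fun j _ => ?_) ⟨i, Finset.mem_univ _, ?_⟩
  · rw [smul_eq_mul, neg_nonneg]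
    exact mul_nonpos_of_nonpos_of_nonneg (hw j).le (mul_self_nonneg _)
  · rw [smul_eq_mul, neg_pos]
    exact mul_neg_of_neg_of_pos (hw i) (mul_self_pos.mpr hi)

/-- Negative weights stay negative under equivalence of diagonal forms (the values of a negative
definite form are negative). [folklore] -/
theorem forall_neg_of_equivalent_weightedSumSquares {ι κ : Type*} [Fintype ι] [Fintype κ]
    [DecidableEq κ] {w : ι → K} {w' : κ → K} (hw : ∀ i, w i < 0)
    (h : Equivalent (weightedSumSquares K w) (weightedSumSquares K w')) (j : κ) : w' j < 0 := by
  obtain ⟨e⟩ := h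
  have h1 : weightedSumSquares K w' (Pi.single j 1) = w' j := by
    rw [weightedSumSquares_apply, Finset.sum_eq_single j]
    · simp
    · intro b _ hb; simp [Pi.single_eq_of_ne hb]
    · exact fun h => (h (Finset.mem_univ j)).elim
  have h2 : weightedSumSquares K w' (Pi.single j 1) = weightedSumSquares K w (e.symm (Pi.single j 1)) := by
    rw [← e.map_app (e.symm (Pi.single j 1)), e.apply_symm_apply]
  have hne : (Pi.single j (1 : K) : κ → K) ≠ 0 := fun h0 => by
    have h0' := congrFun h0 j
    simp at h0'
  rw [← h1, h2]
  refine weightedSumSquares_neg_of_ne_zero hw fun h0 => hne ?_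
  simpa using congrArg e h0

/-- Non-zero weights stay non-zero under equivalence of diagonal forms (the radical has the same
dimension, Mathlib `QuadraticForm.finrank_radical_of_equiv_weightedSumSquares`). [folklore] -/
theorem forall_ne_zero_of_equivalent_weightedSumSquares {ι κ : Type*} [Fintype ι] [Fintype κ]
    {w : ι → K} {w' : κ → K} (hw : ∀ i, w i ≠ 0)
    (h : Equivalent (weightedSumSquares K w) (weightedSumSquares K w')) (j : κ) : w' j ≠ 0 := by
  have h1 := QuadraticForm.finrank_radical_of_equiv_weightedSumSquares h
  have h2 := QuadraticForm.finrank_radical_of_equiv_weightedSumSquares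
    (QuadraticMap.Equivalent.refl (weightedSumSquares K w))
  rw [h2] at h1
  have h3 : {i | w i = 0} = ∅ := Set.eq_empty_of_forall_notMem fun i hi => hw i hi
  rw [h3, Set.ncard_empty] at h1
  have h4 : {i | w' i = 0} = ∅ := (Set.ncard_eq_zero (Set.toFinite _)).mp h1.symm
  exact fun hj => (Set.eq_empty_iff_forall_notMem.mp h4) j hj

/-- **Sylvester's law of inertia** for two equivalent diagonal forms: the same number of positive
weights (Mathlib `QuadraticForm.sigPos_of_equiv_weightedSumSquares`). [folklore] -/
theorem ncard_pos_eq_of_equivalent_weightedSumSquares {ι κ : Type*} [Fintype ι] [Fintype κ]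
    {w : ι → K} {w' : κ → K}
    (h : Equivalent (weightedSumSquares K w) (weightedSumSquares K w')) :
    {i | 0 < w i}.ncard = {j | 0 < w' j}.ncard := by
  rw [← QuadraticForm.sigPos_of_equiv_weightedSumSquares h,
    ← QuadraticForm.sigPos_of_equiv_weightedSumSquares (QuadraticMap.Equivalent.refl _)]

omit [IsStrictOrderedRing K] in
/-- Counting positive weights of a ternary diagonal form. [folklore] -/
theorem ncard_pos_fin_three (w : Fin 3 → K) :
    {i | 0 < w i}.ncard =
      (if 0 < w 0 then 1 else 0) + (if 0 < w 1 then 1 else 0) + (if 0 < w 2 then 1 else 0) := by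
  classical
  have : {i | 0 < w i} = ↑(Finset.univ.filter fun i => 0 < w i) := by
    ext i; simp
  rw [this, Set.ncard_coe_finset, Finset.card_filter, Fin.sum_univ_three]

end Signs

/-! ### Splitting off a represented value -/

section SplitOff

variable {K : Type*} [Field K] [Invertible (2 : K)] {V : Type*} [AddCommGroup V] [Module K V]
  [FiniteDimensional K V]

open LinearMap.BilinForm in
/-- A non-isotropic vector `x` (`B(x, x) ≠ 0`) of a symmetric bilinear form on a space of
dimension `n + 1` is the first vector of an orthogonal basis (Serre, Ch. IV §1.4, proof of the
existence of orthogonal bases; Mathlib `LinearMap.BilinForm.exists_orthogonal_basis`).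
[cite: Serre1973, Ch. IV §1.4] -/
theorem exists_orthogonal_basis_cons {B : LinearMap.BilinForm K V} (hB : LinearMap.IsSymm B)
    {n : ℕ} (hd : finrank K V = n + 1) {x : V} (hx : B x x ≠ 0) :
    ∃ v : Basis (Fin (n + 1)) K V, B.IsOrthoᵢ v ∧ v 0 = x := by
  classical
  have hx0 : x ≠ 0 := fun h => hx (by simp [h])
  have hW : finrank K (B.orthogonal (K ∙ x)) = n := by
    have h1 := Submodule.finrank_add_eq_of_isCompl (isCompl_span_singleton_orthogonal hx).symm
    rw [finrank_span_singleton hx0, hd] at h1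
    omega
  subst hW
  let B' := B.domRestrict₁₂ (B.orthogonal (K ∙ x)) (B.orthogonal (K ∙ x))
  obtain ⟨v', hv₁⟩ := LinearMap.BilinForm.exists_orthogonal_basis (hB.domRestrict _ : B'.IsSymm)
  let b : Basis (Fin (finrank K (B.orthogonal (K ∙ x)) + 1)) K V :=
    Basis.mkFinCons x v'
      (by
        rintro c y hy hc
        rw [add_eq_zero_iff_neg_eq] at hc
        rw [← hc, Submodule.neg_mem_iff] at hy
        have := (isCompl_span_singleton_orthogonal hx).disjoint
        rw [Submodule.disjoint_def] at this
        have := this (c • x) (Submodule.smul_mem _ _ <| Submodule.mem_span_singleton_self _) hy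
        exact (smul_eq_zero.1 this).resolve_right fun h => hx <| h.symm ▸ map_zero _)
      (by
        intro y
        refine ⟨-B x y / B x x, fun z hz => ?_⟩
        obtain ⟨c, rfl⟩ := Submodule.mem_span_singleton.1 hz
        rw [map_smul, LinearMap.smul_apply, map_add, map_smul, smul_eq_mul, smul_eq_mul,
          div_mul_cancel₀ _ hx, add_neg_cancel, mul_zero])
  refine ⟨b, ?_, ?_⟩
  · rw [Basis.coe_mkFinCons]
    intro j i
    refine Fin.cases ?_ (fun i => ?_) i <;> refine Fin.cases ?_ (fun j => ?_) j <;> intro hij <;>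
      simp only [Function.onFun, Fin.cons_zero, Fin.cons_succ, Function.comp_apply]
    · exact (hij rfl).elim
    · rw [← hB.eq]
      exact (v' j).prop _ (Submodule.mem_span_singleton_self x)
    · exact (v' i).prop _ (Submodule.mem_span_singleton_self x)
    · exact hv₁ (ne_of_apply_ne _ hij)
  · rw [Basis.coe_mkFinCons, Fin.cons_zero]

/-- **Splitting off a represented value.** If a quadratic form `Q` on a space of dimension
`n + 1` (characteristic `≠ 2`) takes the value `Q(x) ≠ 0`, then `Q ≅ ⟨Q(x), w'⟩` for some
`w' : Fin n → K`: complete `x` to an orthogonal basis (Serre, Ch. IV §1.4; in particular Cor. 1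
to Prop. 3': a non-degenerate form representing `a` is `∼ ⟨a⟩ ⊕ g`). [cite: Serre1973, Ch. IV §1.4] -/
theorem equivalent_weightedSumSquares_cons_of_ne_zero (Q : QuadraticForm K V) {n : ℕ}
    (hd : finrank K V = n + 1) {x : V} (hx : Q x ≠ 0) :
    ∃ w : Fin n → K,
      Equivalent Q (weightedSumSquares K (Fin.cons (Q x) w : Fin (n + 1) → K)) := by
  have hx' : QuadraticMap.associated (R := K) Q x x ≠ 0 := by
    rwa [QuadraticMap.associated_eq_self_apply]
  obtain ⟨v, hv, hv0⟩ :=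
    exists_orthogonal_basis_cons (QuadraticForm.associated_isSymm K Q) hd hx'
  refine ⟨fun i => Q (v i.succ), ?_⟩
  have h1 : Q.basisRepr v =
      weightedSumSquares K (Fin.cons (Q x) fun i => Q (v i.succ) : Fin (n + 1) → K) := by
    rw [basisRepr_eq_of_iIsOrtho Q v hv]
    congr 1
    ext i
    refine Fin.cases ?_ (fun j => ?_) i
    · rw [Fin.cons_zero, hv0]
    · rw [Fin.cons_succ]
  rw [← h1]
  exact ⟨Q.isometryEquivBasisRepr v⟩

/-- Splitting off a represented value, diagonal case: if `⟨w⟩` on `K^{n+1}` takes the value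
`a ≠ 0` then `⟨w⟩ ≅ ⟨a, w'⟩`. [cite: Serre1973, Ch. IV §1.4] -/
theorem equivalent_weightedSumSquares_cons_of_apply_eq {n : ℕ} (w : Fin (n + 1) → K)
    {v : Fin (n + 1) → K} {a : K} (hv : weightedSumSquares K w v = a) (ha : a ≠ 0) :
    ∃ w' : Fin n → K,
      Equivalent (weightedSumSquares K w) (weightedSumSquares K (Fin.cons a w' : Fin (n + 1) → K)) := by
  subst hv
  exact equivalent_weightedSumSquares_cons_of_ne_zero _ (finrank_fin_fun K) ha

end SplitOff

/-! ### Discriminants -/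

section Discr

variable {K : Type*} [Field K] [Invertible (2 : K)] {n : Type*} [Fintype n] [DecidableEq n]

omit [Invertible (2 : K)] in
/-- `⟨w⟩` is the quadratic form of the diagonal matrix `diag(w)`. [folklore] -/
theorem weightedSumSquares_eq_toQuadraticMap (w : n → K) :
    weightedSumSquares K w = (Matrix.toBilin' (Matrix.diagonal w)).toQuadraticMap := by
  ext v
  rw [weightedSumSquares_apply, LinearMap.BilinMap.toQuadraticMap_apply, Matrix.toBilin'_apply']
  simp only [dotProduct, Matrix.mulVec_diagonal, smul_eq_mul]
  exact Finset.sum_congr rfl fun i _ => by ring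

/-- The discriminant of `⟨w⟩` is `∏ wᵢ`. [folklore] -/
theorem discr'_weightedSumSquares (w : n → K) :
    QuadraticForm.discr' (weightedSumSquares K w) = ∏ i, w i := by
  have hsymm : ∀ x y, Matrix.toBilin' (Matrix.diagonal w) x y =
      Matrix.toBilin' (Matrix.diagonal w) y x :=
    fun x y => (Matrix.isSymm_toBilin'_iff_isSymm.mpr (Matrix.isSymm_diagonal w)).eq x y
  unfold QuadraticForm.discr' QuadraticForm.toMatrix'
  rw [weightedSumSquares_eq_toQuadraticMap, QuadraticMap.associated,
    QuadraticMap.associated_left_inverse _ hsymm]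
  change (LinearMap.BilinForm.toMatrix' (Matrix.toBilin' (Matrix.diagonal w))).det = _
  rw [LinearMap.BilinForm.toMatrix'_toBilin', Matrix.det_diagonal]

/-- **Equivalent diagonal forms have the same discriminant modulo squares**:
`∏ wᵢ = r² ∏ wᵢ'` with `r ≠ 0` (the determinant of the change of basis; Serre, Ch. IV §1.1).
[cite: Serre1973, Ch. IV §1.1] -/
theorem exists_prod_eq_sq_mul_prod {w w' : n → K}
    (h : Equivalent (weightedSumSquares K w) (weightedSumSquares K w')) :
    ∃ r : K, r ≠ 0 ∧ ∏ i, w i = r ^ 2 * ∏ i, w' i := by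
  obtain ⟨e⟩ := h
  have hcomp : weightedSumSquares K w =
      (weightedSumSquares K w').comp (e : (n → K) →ₗ[K] (n → K)) := by
    ext v
    exact (e.map_app v).symm
  refine ⟨(LinearMap.toMatrix' (e : (n → K) →ₗ[K] (n → K))).det, ?_, ?_⟩
  · rw [LinearMap.det_toMatrix']
    exact (LinearEquiv.isUnit_det' (e : (n → K) ≃ₗ[K] (n → K))).ne_zero
  · have := congrArg QuadraticForm.discr' hcomp
    rw [QuadraticForm.discr'_comp, discr'_weightedSumSquares, discr'_weightedSumSquares] at this
    rw [this]
    ring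

end Discr

/-! ### Binary forms -/

section Binary

variable {K : Type*} [Field K]

/-- A binary diagonal form `⟨a, b⟩` representing `g = aX² + bY² ≠ 0` is equivalent to
`⟨g, ab/g⟩`: the vectors `(X, Y)` and `(-bY, aX)/g` form an orthogonal basis (Serre, Ch. IV
§1.4 Cor. 1 to Prop. 3', rank `2`). [cite: Serre1973, Ch. IV §1.4] -/
theorem equivalent_weightedSumSquares_pair (a b X Y : K) (hg : a * X ^ 2 + b * Y ^ 2 ≠ 0) :
    Equivalent
      (weightedSumSquares K ![a * X ^ 2 + b * Y ^ 2, a * b / (a * X ^ 2 + b * Y ^ 2)])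
      (weightedSumSquares K ![a, b]) := by
  have hg' : X ^ 2 * a + Y ^ 2 * b ≠ 0 := fun h => hg (by linear_combination h)
  refine ⟨{ toFun := fun v => ![v 0 * X - v 1 * (b * Y / (a * X ^ 2 + b * Y ^ 2)),
              v 0 * Y + v 1 * (a * X / (a * X ^ 2 + b * Y ^ 2))]
            invFun := fun u => ![(a * X * u 0 + b * Y * u 1) / (a * X ^ 2 + b * Y ^ 2),
              X * u 1 - Y * u 0]
            map_add' := fun v v' => ?_
            map_smul' := fun c v => ?_
            left_inv := fun v => ?_
            right_inv := fun u => ?_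
            map_app' := fun v => ?_ }⟩
  · ext i; fin_cases i <;> simp <;> ring
  · ext i; fin_cases i <;> simp <;> ring
  · ext i
    fin_cases i
    · simp
      field_simp
      ring
    · simp
      field_simp
      ring
  · ext i
    fin_cases i
    · simp
      field_simp
      ring
    · simp
      field_simp
      ring
  · simp only [weightedSumSquares_apply, Fin.sum_univ_two, smul_eq_mul]
    simp
    field_simp
    ring

end Binary

end Literature.NumberTheory.QuadraticForms
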